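import Summits.BirchSwinnertonDyer.BirchSwinnertonDyer.Theorems.ClassRecordThreeEulerHalvesAtThreeCartanTorusCubeCutCyclic
import Mathlib.FieldTheory.Finite.Basic
import HarnessLib

/-!
# Crux 19109 `EulerHalvesAtThree` ∕ 23422 line `cartan` v8′, stub (F2a): the TORUS-CUBE CUT of S-K1′ — towards input (C1):
# the cubic new-vector character on the non-split torus in the cuspidal case `q ≡ 2 (mod 3)` (values and sums, proved)

Seat `bsd-stepL-tam3-p1` g21 (LINE OWNER of crux 23422; `--supports stmt-BirchSwinnertonDyer-23422 --as helper`). CONTENT, all PROVED: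
* §1 the torus `T_C` is commutative, its cubes `T_C³` are closed under multiplication; classification of its elements for odd `q`:
  `a·1 + t·η` is scalar iff `t = 0`, and for `t ≠ 0` it is ELLIPTIC (no rational eigenvalue, non-zero discriminant);
* §2 the values of the cubic new-vector character `χ_W` (`cubicNewvectorChar`, `q ≡ 2 (3)`) on `T_C`: `q − 1` on the `q − 1` scalars,
  `−2` on the other cubes, `1` off the cubes; hence the character sums `Σ_{T_C} χ_W = |T_C|` and `Σ_{T_C³} χ_W = |T_C³|`
  (`sum_char_nonsplitTorus`, `sum_char_nonsplitCubes`);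
  These two sums are the character input of (C1) (`…CartanTorusCubeCutCuspNorm`: `3·N_{T_C³} = N_{T_C}`).
HONEST FRAMING: finite-field counting in `GL₂(𝔽_q)`; nothing about any curve, `L`-value or period; S-K1′ is NOT proved here
(inputs (C1), (C2), (P1)–(P3) of the cut remain at this file); no summit statement, no route item and no registered stub is proved; BSD is proved for no
curve. [folklore; background: cite: Bump1997, §4.1]
-/

namespace Summit.BirchSwinnertonDyer.BirchSwinnertonDyer.Theorems.CartanTorusCubeCut

open Summit.BirchSwinnertonDyer.BirchSwinnertonDyer.Theorems.CartanDegree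

open scoped Classical

set_option linter.dupNamespace false
set_option autoImplicit false

noncomputable section

variable {q : ℕ} [Fact q.Prime]

/-! ### §1 The torus is commutative; cubes are closed under multiplication; scalar ∕ elliptic classification -/

/-- `pmul` is commutative. -/
theorem pmul_comm (η : Mat q) (p p' : ZMod q × ZMod q) : pmul η p p' = pmul η p' p := by
  simp only [pmul]; ext <;> ring

/-- **`T_C` is commutative** (both elements are polynomials in `η`). -/
theorem nonsplitTorus_comm {η : Mat q} (hη : ¬ HasRatEigenvalue η) {u s : G q}
    (hu : u ∈ nonsplitTorus η) (hs : s ∈ nonsplitTorus η) : u * s = s * u := by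
  apply Units.ext
  rw [Units.val_mul, Units.val_mul, ← lin_coord_of_mem hη (mem_nonsplitTorus_iff.1 hu),
    ← lin_coord_of_mem hη (mem_nonsplitTorus_iff.1 hs), lin_mul_lin, lin_mul_lin, pmul_comm]

/-- cubes lie in the torus. -/
theorem nonsplitCubes_subset (η : Mat q) {t : G q} (ht : t ∈ nonsplitCubes η) : t ∈ nonsplitTorus η := by
  simpa [nonsplitTorus] using mem_nonsplitTorus_of_mem_cubes ht

/-- **`T_C³` is closed under multiplication** (`a³b³ = (ab)³` in the commutative `T_C`). -/
theorem nonsplitCubes_mul_mem {η : Mat q} (hη : ¬ HasRatEigenvalue η) {u s : G q}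
    (hu : u ∈ nonsplitCubes η) (hs : s ∈ nonsplitCubes η) : u * s ∈ nonsplitCubes η := by
  simp only [nonsplitCubes, Finset.mem_image] at hu hs ⊢
  obtain ⟨a, ha, rfl⟩ := hu
  obtain ⟨b, hb, rfl⟩ := hs
  refine ⟨a * b, nonsplitTorus_mul_mem ha hb, ?_⟩
  exact ((show Commute a b from nonsplitTorus_comm hη ha hb).mul_pow 3)

/-- `a·1 + t·η` is scalar iff `t = 0`. -/
theorem isScalarMat_lin_iff {η : Mat q} (hη : ¬ HasRatEigenvalue η) (p : ZMod q × ZMod q) :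
    IsScalarMat (lin η p) ↔ p.2 = 0 := by
  have hf := entry01_ne_zero hη
  constructor
  · intro h
    have h01 := h.1
    simp only [lin, Matrix.add_apply, Matrix.smul_apply, Matrix.one_apply_ne (by decide : (0 : Fin 2) ≠ 1),
      smul_eq_mul, mul_zero, zero_add] at h01
    rcases mul_eq_zero.1 h01 with h0 | h0
    · exact h0
    · exact absurd h0 hf
  · intro h
    refine ⟨?_, ?_, ?_⟩ <;>
      simp [lin, h, Matrix.one_apply_ne (by decide : (0 : Fin 2) ≠ 1),
        Matrix.one_apply_ne (by decide : (1 : Fin 2) ≠ 0)]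

/-- the discriminant of `a·1 + t·η` is `t²` times that of `η`. -/
theorem disc_lin (η : Mat q) (p : ZMod q × ZMod q) :
    (lin η p).trace ^ 2 - 4 * (lin η p).det = p.2 ^ 2 * (η.trace ^ 2 - 4 * η.det) := by
  have htr : (lin η p).trace = 2 * p.1 + p.2 * η.trace := by
    simp only [lin, Matrix.trace_fin_two, Matrix.add_apply, Matrix.smul_apply, Matrix.one_apply_eq, smul_eq_mul,
      mul_one]
    ring
  rw [htr, det_lin]
  ring

/-- `2 ≠ 0` in `𝔽_q` for a prime `q ≥ 5`. -/
theorem two_ne_zero_of_five_le (hq5 : 5 ≤ q) : (2 : ZMod q) ≠ 0 := by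
  intro h
  have h' : ((2 : ℕ) : ZMod q) = 0 := by exact_mod_cast h
  rw [ZMod.natCast_eq_zero_iff] at h'
  have := Nat.le_of_dvd (by norm_num) h'
  omega

/-- for odd `q`, a matrix without rational eigenvalue has non-zero discriminant (else `tr η / 2` is an eigenvalue). -/
theorem disc_ne_zero {η : Mat q} (hη : ¬ HasRatEigenvalue η) (h2 : (2 : ZMod q) ≠ 0) :
    η.trace ^ 2 - 4 * η.det ≠ 0 := by
  intro h
  apply hη
  refine ⟨η.trace * 2⁻¹, ?_⟩
  have e : η.trace ^ 2 = 4 * η.det := sub_eq_zero.1 h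
  have h22 : (2 : ZMod q) * 2⁻¹ = 1 := mul_inv_cancel₀ h2
  linear_combination (η.det * (2 * (2 : ZMod q)⁻¹ - 1)) * h22 + ((2 : ZMod q)⁻¹ ^ 2 - 2⁻¹) * e

/-- **non-scalar elements of `T_C` are elliptic**: `a·1 + t·η` with `t ≠ 0` has no rational eigenvalue. -/
theorem not_hasRatEigenvalue_lin {η : Mat q} (hη : ¬ HasRatEigenvalue η) {p : ZMod q × ZMod q} (hp : p.2 ≠ 0) :
    ¬ HasRatEigenvalue (lin η p) := by
  rintro ⟨x, hx⟩
  apply hη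
  refine ⟨(x - p.1) * p.2⁻¹, ?_⟩
  have htr : (lin η p).trace = 2 * p.1 + p.2 * η.trace := by
    simp only [lin, Matrix.trace_fin_two, Matrix.add_apply, Matrix.smul_apply, Matrix.one_apply_eq, smul_eq_mul,
      mul_one]
    ring
  rw [htr, det_lin] at hx
  have hinv : p.2 * p.2⁻¹ = 1 := mul_inv_cancel₀ hp
  have key : ((x - p.1) * p.2⁻¹) * ((x - p.1) * p.2⁻¹) + η.det - η.trace * ((x - p.1) * p.2⁻¹)
      = (p.2⁻¹ * p.2⁻¹) * (x * x + (p.1 * p.1 + p.1 * p.2 * η.trace + p.2 * p.2 * η.det)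
          - (2 * p.1 + p.2 * η.trace) * x) := by
    field_simp
    ring
  rw [hx, sub_self, mul_zero] at key
  exact sub_eq_zero.1 key

/-! ### §2 The cubic new-vector character on `T_C` in the cuspidal case `q ≡ 2 (mod 3)` -/

section Cusp

variable {η : Mat q}

/-- `q² − 1 = (q − 1)(q + 1)` in `ℕ`. -/
theorem sq_sub_one_eq (q : ℕ) : q ^ 2 - 1 = (q - 1) * (q + 1) := by
  have h := Nat.sq_sub_sq q 1
  rw [one_pow] at h
  rw [h, mul_comm]

/-- a scalar element of `T_C` is a cube when `q ≡ 2 (3)`: `(a·1)^{(q²−1)/3} = 1` since `q − 1 ∣ (q² − 1)/3`. -/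
theorem scalar_pow_eq_one (hq3 : q % 3 = 2) {t : G q}
    (hsc : IsScalarMat (t : Mat q)) : (t : Mat q) ^ ((q - 1) * (q + 1) / 3) = 1 := by
  obtain ⟨h01, h10, h00⟩ := hsc
  set a : ZMod q := (t : Mat q) 0 0 with ha
  have hmat : (t : Mat q) = a • (1 : Mat q) := by
    ext i j
    fin_cases i <;> fin_cases j <;> simp [h01, h10, ← h00, ← ha]
  have ha0 : a ≠ 0 := by
    intro h0
    have hdet : (t : Mat q).det = 0 := by rw [hmat, h0, zero_smul, Matrix.det_zero]
    have hu : IsUnit (t : Mat q).det := by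
      rw [← Matrix.isUnit_iff_isUnit_det]; exact Units.isUnit t
    exact not_isUnit_zero (hdet ▸ hu)
  have hfermat : a ^ (q - 1) = 1 := ZMod.pow_card_sub_one_eq_one ha0
  obtain ⟨m, hm⟩ : 3 ∣ q + 1 := by omega
  have he : (q - 1) * (q + 1) / 3 = (q - 1) * m := by
    rw [hm, ← mul_assoc, mul_comm (q - 1) 3, mul_assoc, Nat.mul_div_cancel_left _ (by norm_num)]
  rw [hmat, he, _root_.smul_pow, one_pow, pow_mul, hfermat, one_pow, one_smul]

/-- **the values of `χ_W` on `T_C` (`q ≡ 2 (3)`)**: for `t ∈ T_C`,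
`χ_W(t) = 1 − 3·[t ∈ T_C³] + (q + 1)·[t scalar]` (i.e. `q − 1` on scalars, `−2` on non-scalar cubes, `1` off the cubes). -/
theorem char_nonsplitTorus (hη : ¬ HasRatEigenvalue η) (hq5 : 5 ≤ q) (hq3 : q % 3 = 2) {t : G q}
    (ht : t ∈ nonsplitTorus η) :
    cubicNewvectorChar q t = 1 - 3 * (if t ∈ nonsplitCubes η then 1 else 0)
      + ((q : ℤ) + 1) * (if IsScalarMat (t : Mat q) then 1 else 0) := by
  have hq1 : ¬ q % 3 = 1 := by omega
  have hcube : t ∈ nonsplitCubes η ↔ (t : Mat q) ^ ((q ^ 2 - 1) / 3) = 1 := by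
    rw [sq_sub_one_eq]; exact mem_nonsplitCubes_iff hη hq5 ht
  -- coordinates
  set p := coord η (t : Mat q) with hp
  have htlin : (t : Mat q) = lin η p := (lin_coord_of_mem hη (mem_nonsplitTorus_iff.1 ht)).symm
  unfold cubicNewvectorChar cubicNewvectorCharMat
  simp only [hq1, if_false]
  by_cases hsc : IsScalarMat (t : Mat q)
  · -- scalar: Δ = 0, value q − 1; and t is a cube
    have hp2 : p.2 = 0 := (isScalarMat_lin_iff hη p).1 (htlin ▸ hsc)
    have hΔ : (t : Mat q).trace ^ 2 - 4 * (t : Mat q).det = 0 := by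
      rw [htlin, disc_lin, hp2]; ring
    have hc : t ∈ nonsplitCubes η := hcube.2 (by rw [sq_sub_one_eq]; exact scalar_pow_eq_one hq3 hsc)
    simp only [hΔ, if_true, hsc, hc]
    ring
  · -- non-scalar: elliptic
    have hp2 : p.2 ≠ 0 := fun h => hsc (htlin ▸ (isScalarMat_lin_iff hη p).2 h)
    have hΔ : (t : Mat q).trace ^ 2 - 4 * (t : Mat q).det ≠ 0 := by
      rw [htlin, disc_lin]
      exact mul_ne_zero (pow_ne_zero 2 hp2) (disc_ne_zero hη (two_ne_zero_of_five_le hq5))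
    have hell : ¬ HasRatEigenvalue (t : Mat q) := by rw [htlin]; exact not_hasRatEigenvalue_lin hη hp2
    simp only [hΔ, if_false, hell, hsc]
    by_cases hc : t ∈ nonsplitCubes η
    · simp only [hc, if_true, hcube.1 hc]; ring
    · have : ¬ (t : Mat q) ^ ((q ^ 2 - 1) / 3) = 1 := fun h => hc (hcube.2 h)
      simp only [hc, if_false, this]; ring

/-- the scalar elements of `T_C`, in coordinates: `{(a, 0) : a ≠ 0}`; there are `q − 1` of them. -/
theorem card_scalar_nonsplitTorus (hη : ¬ HasRatEigenvalue η) :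
    ((nonsplitTorus η).filter (fun t : G q => IsScalarMat (t : Mat q))).card = q - 1 := by
  have himg : (nonsplitTorus η).filter (fun t : G q => IsScalarMat (t : Mat q)) =
      ((Finset.univ : Finset (ZMod q)).erase 0).image (fun a => linGL η hη (a, 0)) := by
    ext t
    simp only [Finset.mem_filter, Finset.mem_image, Finset.mem_erase, Finset.mem_univ, and_true, ne_eq]
    constructor
    · rintro ⟨ht, hsc⟩
      have htlin := lin_coord_of_mem hη (mem_nonsplitTorus_iff.1 ht)
      set p := coord η (t : Mat q) with hp
      have hp2 : p.2 = 0 := (isScalarMat_lin_iff hη p).1 (htlin.symm ▸ hsc)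
      have hp0 : p ≠ 0 := by
        intro h0
        have hdet : (t : Mat q).det = 0 := by
          rw [← htlin, h0]; simp [lin]
        have hu : IsUnit (t : Mat q).det := by
          rw [← Matrix.isUnit_iff_isUnit_det]; exact Units.isUnit t
        exact not_isUnit_zero (hdet ▸ hu)
      have hp1 : p.1 ≠ 0 := fun h1 => hp0 (Prod.ext h1 hp2)
      have hp10 : ((p.1, 0) : ZMod q × ZMod q) ≠ 0 := fun h => hp1 (congrArg Prod.fst h)
      refine ⟨p.1, hp1, ?_⟩
      apply Units.ext
      rw [linGL_coe hη (p := (p.1, 0)) hp10, ← htlin]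
      congr 1
      exact (Prod.ext rfl hp2.symm)
    · rintro ⟨a, ha, rfl⟩
      have hp0 : ((a, 0) : ZMod q × ZMod q) ≠ 0 := fun h => ha (congrArg Prod.fst h)
      refine ⟨?_, ?_⟩
      · rw [nonsplitTorus_eq_image hη, Finset.mem_image]
        exact ⟨(a, 0), Finset.mem_erase.2 ⟨hp0, Finset.mem_univ _⟩, rfl⟩
      · rw [linGL_coe hη hp0]
        exact (isScalarMat_lin_iff hη (a, 0)).2 rfl
  rw [himg, Finset.card_image_of_injOn, Finset.card_erase_of_mem (Finset.mem_univ _), Finset.card_univ, ZMod.card]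
  intro a ha b hb hab
  simp only [Finset.coe_erase, Set.mem_sdiff, Finset.mem_coe, Finset.mem_univ, Set.mem_singleton_iff, true_and] at ha hb
  have hpa : ((a, 0) : ZMod q × ZMod q) ≠ 0 := fun h => ha (congrArg Prod.fst h)
  have hpb : ((b, 0) : ZMod q × ZMod q) ≠ 0 := fun h => hb (congrArg Prod.fst h)
  have := congrArg (fun g : G q => (g : Mat q)) hab
  simp only [linGL_coe hη hpa, linGL_coe hη hpb] at this
  exact congrArg Prod.fst (lin_injective hη this)

/-- scalars of `T_C` are cubes (`q ≡ 2 (3)`). -/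
theorem scalar_mem_nonsplitCubes (hη : ¬ HasRatEigenvalue η) (hq5 : 5 ≤ q) (hq3 : q % 3 = 2) {t : G q}
    (ht : t ∈ nonsplitTorus η) (hsc : IsScalarMat (t : Mat q)) : t ∈ nonsplitCubes η :=
  (mem_nonsplitCubes_iff hη hq5 ht).2 (scalar_pow_eq_one hq3 hsc)

/-- **`Σ_{t ∈ T_C} χ_W(t) = |T_C|`** (`q ≡ 2 (3)`). -/
theorem sum_char_nonsplitTorus (hη : ¬ HasRatEigenvalue η) (hq5 : 5 ≤ q) (hq3 : q % 3 = 2) :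
    ∑ t ∈ nonsplitTorus η, cubicNewvectorChar q t = ((nonsplitTorus η).card : ℤ) := by
  rw [Finset.sum_congr rfl (fun t ht => char_nonsplitTorus hη hq5 hq3 ht)]
  rw [Finset.sum_add_distrib, Finset.sum_sub_distrib, ← Finset.mul_sum, ← Finset.mul_sum, Finset.sum_boole,
    Finset.sum_boole, Finset.sum_const, Finset.filter_mem_eq_inter,
    Finset.inter_eq_right.2 (fun t ht => nonsplitCubes_subset η ht), card_scalar_nonsplitTorus hη]
  have h3 := nonsplitCubes_card hη hq5
  have hT := nonsplitTorus_card hη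
  have hq1 : 1 ≤ q := by omega
  simp only [nsmul_eq_mul, mul_one]
  rw [hT, Nat.cast_sub hq1]
  push_cast
  have h3' : (3 : ℤ) * ((nonsplitCubes η).card : ℤ) = ((q : ℤ) - 1) * ((q : ℤ) + 1) := by
    have := congrArg (fun n : ℕ => (n : ℤ)) h3
    push_cast [Nat.cast_sub hq1] at this
    exact this
  linear_combination (-1 : ℤ) * h3'

/-- **`Σ_{t ∈ T_C³} χ_W(t) = |T_C³|`** (`q ≡ 2 (3)`). -/
theorem sum_char_nonsplitCubes (hη : ¬ HasRatEigenvalue η) (hq5 : 5 ≤ q) (hq3 : q % 3 = 2) :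
    ∑ t ∈ nonsplitCubes η, cubicNewvectorChar q t = ((nonsplitCubes η).card : ℤ) := by
  rw [Finset.sum_congr rfl (fun t ht => char_nonsplitTorus hη hq5 hq3 (nonsplitCubes_subset η ht))]
  rw [Finset.sum_add_distrib, Finset.sum_sub_distrib, ← Finset.mul_sum, ← Finset.mul_sum, Finset.sum_boole,
    Finset.sum_boole, Finset.sum_const, Finset.filter_mem_eq_inter, Finset.inter_self]
  -- the scalars of `T_C³` are the scalars of `T_C`
  have hsc : (nonsplitCubes η).filter (fun t : G q => IsScalarMat (t : Mat q)) =
      (nonsplitTorus η).filter (fun t : G q => IsScalarMat (t : Mat q)) := by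
    ext t
    simp only [Finset.mem_filter]
    constructor
    · rintro ⟨ht, hs⟩; exact ⟨nonsplitCubes_subset η ht, hs⟩
    · rintro ⟨ht, hs⟩; exact ⟨scalar_mem_nonsplitCubes hη hq5 hq3 ht hs, hs⟩
  rw [hsc, card_scalar_nonsplitTorus hη]
  have h3 := nonsplitCubes_card hη hq5
  have hq1 : 1 ≤ q := by omega
  simp only [nsmul_eq_mul, mul_one]
  rw [Nat.cast_sub hq1]
  push_cast
  have h3' : (3 : ℤ) * ((nonsplitCubes η).card : ℤ) = ((q : ℤ) - 1) * ((q : ℤ) + 1) := by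
    have := congrArg (fun n : ℕ => (n : ℤ)) h3
    push_cast [Nat.cast_sub hq1] at this
    exact this
  linear_combination (-1 : ℤ) * h3'

end Cusp

end

end Summit.BirchSwinnertonDyer.BirchSwinnertonDyer.Theorems.CartanTorusCubeCut
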